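import Mathlib
import Summits.MatrixMultiplication.Statement
import Summits.MatrixMultiplication.MatrixMultiplication.Theorems.GraphEquationsNullExpLadder
import Summits.MatrixMultiplication.MatrixMultiplication.Theorems.GraphEquationsExactEngineTwo
import Summits.MatrixMultiplication.MatrixMultiplication.Theorems.GraphEquationsExactMembers

/-!
# Graph equations — THE DIAL OF THE MEMBERSHIP LADDER (M20a, decomp-mm-lens-5 g33)

(supports `MultiplicityReduction`, stmt-MatrixMultiplication-27806; companion of
`GraphEquationsNullExpLadder` (M19e), `GraphEquationsDeepDeflation` (M19d) and the exact engines
`GraphEquationsExactMembers` / `GraphEquationsExactEngineTwo` (M19i/M19m).  No new definition.)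

Lens 5 asks of the finite range «how far must it reach before the asymptotic regime takes over».
On the membership-exponent ladder the answer is ONE FUNCTION `Φ : ℕ → ℝ`, the COST OF RUNG `e` in
RANK FORM:

  RUNG_Φ(e) :  every CORRECT system `E` of format `n` with `f_q^e ∈ J_E` for all `q` satisfies
               `R(⟨n,n,n⟩) ≤ Φ(e) · (cost E + n²)`;
  HAND_Φ    :  for `β ≥ 2` admissible and `β' > β` there are correct systems `E_n` and exponents
               `e_n ≥ 1` with `f_q^{e_n} ∈ J_{E_n}` and `Φ(e_n) · (cost E_n + n²) ≤ c · n^{β'}`.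

* `multiplicityReduction_of_dial` — **THE DIAL BRIDGE**: `(∀ e ≥ 1, RUNG_Φ(e)) ∧ HAND_Φ ⇒
  MultiplicityReduction` (midpoint exponent; the rank bound makes the midpoint admissible for `ω`).
  The membership exponent may now GROW WITH `n`: the hand only asks that the rung cost `Φ(e_n)` be
  absorbed by the slack `n^{β'-β}` — for geometric `Φ(e) = C^e` this is `e_n ≤ (β'-β)·log_C n + O(1)`.
* `dialHand_of_matrixMultiplication` — HAND_Φ is NECESSARY for EVERY `Φ` (`ω = 2 ⇒` generator
  systems, `e_n = 1`, `exists_correct_generator_mem_of_omega_lt`);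
  `dialHand_of_nullExpReduction` — and WEAKER than NER (a uniform exponent is the constant dial).
* `nullExpPurification_of_rankRung` — the by-name conversion RUNG_Φ(e) ⇒ NEP_e (the admissibility
  rung of M19e); `nullExpPurification_three_of_rankRungThree` — the rung-`3` target BY NAME: its
  hypothesis `∀ n E, Correct → (∀ q, f_q³ ∈ J_E) → R(⟨n,n,n⟩) ≤ C·cost` is what a level-`2` engine
  (`tensorRank_le_of_cubeMembers_affine2_sel`, M19r, `C = 18`) must be fed.
* PROVED RUNGS in rank form, by name: `rankRung_one` (`Φ(1) = 2`, M19i), `rankRung_two`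
  (`Φ(2) = 6`, M19m), and on TIGHT systems (tests in `I^{e-1}`) EVERY rung with the explicit
  geometric constant `Φ(k+2) = 6·4^k` (`rankRung_tight`, M19d + M19m).
* `omega_le_of_tight_growth` / `eqAdmissibleRed_of_tight_growth` — **UNCONDITIONAL LOG-GROWTH
  PURIFICATION**: a family of correct TIGHT systems whose membership exponents `e_n = k_n + 2` satisfy
  `4^{k_n} · (cost E_n + n²) ≤ c · n^β` forces `ω ≤ β`; the exponent need not be bounded
  (`k_n ≤ δ·log₄ n` is absorbed by `β + δ`).  Contrapositively: below `ω`, cheap tight families have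
  membership exponent `> (ω - β - o(1)) · log₄ n`.
* `multiplicityReduction_of_dial_ge_three` — where the crux stands on the dial: rungs `e ≤ 2` plugged
  in, `MultiplicityReduction ⟸ (∀ e ≥ 3, RUNG_Ψ(e)) ∧ HAND_{6,6,Ψ(3),Ψ(4),…}`.
-/

set_option linter.dupNamespace false

noncomputable section

open scoped BigOperators

namespace Summit.MatrixMultiplication.MatrixMultiplication.Theorems.GraphEquations

open MvPolynomial
open Literature.Computability.AlgebraicComplexity
open Literature.Computability.AlgebraicComplexity.ArithCircuit

variable {n : ℕ}

/-! ## Two arithmetic helpers -/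

/-- A uniform bound `R(⟨n,n,n⟩) ≤ K·n^β` for `n ≥ 1` gives `ω ≤ β`. -/
theorem omega_le_of_rank_family_le {β K : ℝ}
    (h : ∀ n : ℕ, 1 ≤ n → (tensorRank (matMulTensor ℂ n n n) : ℝ) ≤ K * (n : ℝ) ^ β) :
    omega ℂ ≤ β := by
  have hmem : β ∈ admissibleExponents ℂ := by
    change (fun n : ℕ => (tensorRank (matMulTensor ℂ n n n) : ℝ)) =O[Filter.atTop]
      fun n : ℕ => (n : ℝ) ^ β
    refine Asymptotics.IsBigO.of_bound |K| ?_
    filter_upwards [Filter.eventually_ge_atTop 1] with n hn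
    rw [Real.norm_of_nonneg (Nat.cast_nonneg _),
      Real.norm_of_nonneg (Real.rpow_nonneg (Nat.cast_nonneg _) _)]
    exact (h n hn).trans
      (mul_le_mul_of_nonneg_right (le_abs_self K) (Real.rpow_nonneg (Nat.cast_nonneg _) _))
  exact csInf_le (admissibleExponents_bddBelow ℂ) hmem

/-- `n² ≤ n^β` for `n ≥ 1`, `β ≥ 2`. -/
theorem natCast_mul_self_le_rpow {n : ℕ} (hn : 1 ≤ n) {β : ℝ} (hβ : 2 ≤ β) :
    (n : ℝ) * n ≤ (n : ℝ) ^ β := by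
  have hn1 : (1 : ℝ) ≤ n := by exact_mod_cast hn
  have h := Real.rpow_le_rpow_of_exponent_le hn1 (show ((2 : ℕ) : ℝ) ≤ β by exact_mod_cast hβ)
  rw [Real.rpow_natCast, sq] at h
  exact h

/-- Bookkeeping: `Φe · (cost + n²) ≤ max Φe 0 · (c+1) · n^β` when `cost ≤ c·n^β`, `n ≥ 1`, `β ≥ 2`. -/
theorem dial_absorb {n : ℕ} (hn : 1 ≤ n) {β : ℝ} (hβ : 2 ≤ β) (Φe c : ℝ) {E : EqSystem n}
    (hcost : (E.cost : ℝ) ≤ c * (n : ℝ) ^ β) :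
    Φe * ((E.cost : ℝ) + n * n) ≤ max Φe 0 * (c + 1) * (n : ℝ) ^ β := by
  have hsq := natCast_mul_self_le_rpow hn hβ
  have hX : (E.cost : ℝ) + n * n ≤ (c + 1) * (n : ℝ) ^ β := by linarith
  calc Φe * ((E.cost : ℝ) + n * n) ≤ max Φe 0 * ((E.cost : ℝ) + n * n) :=
        mul_le_mul_of_nonneg_right (le_max_left _ _) (by positivity)
    _ ≤ max Φe 0 * ((c + 1) * (n : ℝ) ^ β) := mul_le_mul_of_nonneg_left hX (le_max_right _ _)
    _ = max Φe 0 * (c + 1) * (n : ℝ) ^ β := by ring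

/-! ## Rank rungs ⇒ admissibility rungs (the by-name conversion) -/

/-- **RUNG_Φ(e) ⇒ NEP_e.**  A rank bound `R(⟨n,n,n⟩) ≤ C·(cost + n²)` for every correct system with
`f_q^e ∈ J_E` gives rung `e` of the membership ladder (M19e): such families at cost `n^β` force
`EqAdmissibleRed β'` for every `β' > β`. -/
theorem nullExpPurification_of_rankRung (e : ℕ) (C : ℝ)
    (hR : ∀ n : ℕ, 1 ≤ n → ∀ E : EqSystem n, E.Correct →
      (∀ q : Fin n × Fin n, generator n q ^ e ∈
        Ideal.span (Set.range fun o : Fin E.tests.length => E.testPoly (E.tests.get o))) →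
      (tensorRank (matMulTensor ℂ n n n) : ℝ) ≤ C * ((E.cost : ℝ) + n * n)) :
    ∀ β : ℝ, 2 ≤ β →
      (∃ c : ℝ, ∀ n : ℕ, 1 ≤ n → ∃ E : EqSystem n, E.Correct ∧
        (∀ q : Fin n × Fin n, generator n q ^ e ∈
          Ideal.span (Set.range fun o : Fin E.tests.length => E.testPoly (E.tests.get o))) ∧
        (E.cost : ℝ) ≤ c * (n : ℝ) ^ β) →
      ∀ β' : ℝ, β < β' → EqAdmissibleRed β' := by
  intro β hβ h β' hβ'
  obtain ⟨c, hc⟩ := h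
  refine eqAdmissibleRed_of_omega_lt (lt_of_le_of_lt
    (omega_le_of_rank_family_le (K := max C 0 * (c + 1)) fun n hn => ?_) hβ')
  obtain ⟨E, hE, hmem, hcost⟩ := hc n hn
  exact (hR n hn E hE hmem).trans (dial_absorb hn hβ C c hcost)

/-- **The rung-`3` target BY NAME.**  A uniform rank bound for correct systems with CUBE members —
the output of a level-`2` exact engine — gives NEP₃. -/
theorem nullExpPurification_three_of_rankRungThree (C : ℝ)
    (hR : ∀ n : ℕ, 1 ≤ n → ∀ E : EqSystem n, E.Correct →
      (∀ q : Fin n × Fin n, generator n q ^ 3 ∈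
        Ideal.span (Set.range fun o : Fin E.tests.length => E.testPoly (E.tests.get o))) →
      (tensorRank (matMulTensor ℂ n n n) : ℝ) ≤ C * (E.cost : ℝ)) :
    ∀ β : ℝ, 2 ≤ β →
      (∃ c : ℝ, ∀ n : ℕ, 1 ≤ n → ∃ E : EqSystem n, E.Correct ∧
        (∀ q : Fin n × Fin n, generator n q ^ 3 ∈
          Ideal.span (Set.range fun o : Fin E.tests.length => E.testPoly (E.tests.get o))) ∧
        (E.cost : ℝ) ≤ c * (n : ℝ) ^ β) →
      ∀ β' : ℝ, β < β' → EqAdmissibleRed β' := by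
  refine nullExpPurification_of_rankRung 3 (max C 0) fun n hn E hE hmem => (hR n hn E hE hmem).trans ?_
  have h0 : (0 : ℝ) ≤ (n : ℝ) * n := by positivity
  calc C * (E.cost : ℝ) ≤ max C 0 * (E.cost : ℝ) :=
        mul_le_mul_of_nonneg_right (le_max_left _ _) (Nat.cast_nonneg _)
    _ ≤ max C 0 * ((E.cost : ℝ) + n * n) :=
        mul_le_mul_of_nonneg_left (le_add_of_nonneg_right h0) (le_max_right _ _)

/-! ## The dial -/

/-- **THE DIAL BRIDGE.**  Rungs in rank form with cost function `Φ`, and the `Φ`-weighted hand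
(membership exponents may grow with `n` as long as `Φ(e_n)·(cost + n²) = O(n^{β'})`), give
`MultiplicityReduction`. -/
theorem multiplicityReduction_of_dial (Φ : ℕ → ℝ)
    (hRUNG : ∀ e : ℕ, 1 ≤ e → ∀ n : ℕ, 1 ≤ n → ∀ E : EqSystem n, E.Correct →
      (∀ q : Fin n × Fin n, generator n q ^ e ∈
        Ideal.span (Set.range fun o : Fin E.tests.length => E.testPoly (E.tests.get o))) →
      (tensorRank (matMulTensor ℂ n n n) : ℝ) ≤ Φ e * ((E.cost : ℝ) + n * n))
    (hHAND : ∀ β : ℝ, 2 ≤ β → EqAdmissible β → ∀ β' : ℝ, β < β' →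
      ∃ c : ℝ, ∀ n : ℕ, 1 ≤ n → ∃ E : EqSystem n, E.Correct ∧ ∃ e : ℕ, 1 ≤ e ∧
        (∀ q : Fin n × Fin n, generator n q ^ e ∈
          Ideal.span (Set.range fun o : Fin E.tests.length => E.testPoly (E.tests.get o))) ∧
        Φ e * ((E.cost : ℝ) + n * n) ≤ c * (n : ℝ) ^ β') :
    MultiplicityReduction := by
  intro β hβ hA β' hβ'
  obtain ⟨c, hc⟩ := hHAND β hβ hA ((β + β') / 2) (by linarith)
  refine eqAdmissibleRed_of_omega_lt (lt_of_le_of_lt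
    (omega_le_of_rank_family_le (K := c) (β := (β + β') / 2) fun n hn => ?_) (by linarith))
  obtain ⟨E, hE, e, he, hmem, hΦ⟩ := hc n hn
  exact (hRUNG e he n hn E hE hmem).trans hΦ

/-- **The `Φ`-hand is NECESSARY, for every `Φ`**: `ω = 2` gives generator systems (`e_n = 1`) at
every cost exponent `β' > 2`. -/
theorem dialHand_of_matrixMultiplication (Φ : ℕ → ℝ) (hS : _root_.MatrixMultiplication) :
    ∀ β : ℝ, 2 ≤ β → EqAdmissible β → ∀ β' : ℝ, β < β' →
      ∃ c : ℝ, ∀ n : ℕ, 1 ≤ n → ∃ E : EqSystem n, E.Correct ∧ ∃ e : ℕ, 1 ≤ e ∧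
        (∀ q : Fin n × Fin n, generator n q ^ e ∈
          Ideal.span (Set.range fun o : Fin E.tests.length => E.testPoly (E.tests.get o))) ∧
        Φ e * ((E.cost : ℝ) + n * n) ≤ c * (n : ℝ) ^ β' := by
  intro β hβ _ β' hβ'
  have h2 : omega ℂ = 2 := hS
  have hω : omega ℂ < β' := by rw [h2]; linarith
  obtain ⟨c, hc⟩ := exists_correct_generator_mem_of_omega_lt hω
  refine ⟨max (Φ 1) 0 * (c + 1), fun n hn => ?_⟩
  obtain ⟨E, hE, hmem, hcost⟩ := hc n hn
  exact ⟨E, hE, 1, le_rfl, hmem, dial_absorb hn (by linarith) (Φ 1) c hcost⟩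

/-- **The `Φ`-hand is WEAKER than NER** (uniform membership exponent along cheaper families): a
constant exponent is the constant dial. -/
theorem dialHand_of_nullExpReduction (Φ : ℕ → ℝ)
    (hNER : ∀ β : ℝ, 2 ≤ β → EqAdmissible β → ∀ β' : ℝ, β < β' →
      ∃ e : ℕ, 1 ≤ e ∧ ∃ c : ℝ, ∀ n : ℕ, 1 ≤ n → ∃ E : EqSystem n, E.Correct ∧
        (∀ q : Fin n × Fin n, generator n q ^ e ∈
          Ideal.span (Set.range fun o : Fin E.tests.length => E.testPoly (E.tests.get o))) ∧
        (E.cost : ℝ) ≤ c * (n : ℝ) ^ β') :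
    ∀ β : ℝ, 2 ≤ β → EqAdmissible β → ∀ β' : ℝ, β < β' →
      ∃ c : ℝ, ∀ n : ℕ, 1 ≤ n → ∃ E : EqSystem n, E.Correct ∧ ∃ e : ℕ, 1 ≤ e ∧
        (∀ q : Fin n × Fin n, generator n q ^ e ∈
          Ideal.span (Set.range fun o : Fin E.tests.length => E.testPoly (E.tests.get o))) ∧
        Φ e * ((E.cost : ℝ) + n * n) ≤ c * (n : ℝ) ^ β' := by
  intro β hβ hA β' hβ'
  obtain ⟨e, he, c, hc⟩ := hNER β hβ hA β' hβ'
  refine ⟨max (Φ e) 0 * (c + 1), fun n hn => ?_⟩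
  obtain ⟨E, hE, hmem, hcost⟩ := hc n hn
  exact ⟨E, hE, e, he, hmem, dial_absorb hn (by linarith) (Φ e) c hcost⟩

/-- The `Φ`-hand is ANTITONE in `Φ`: a cheaper ladder asks less of the asymptotic regime. -/
theorem dialHand_mono {Φ Ψ : ℕ → ℝ} (hle : ∀ e, Φ e ≤ Ψ e)
    (hΨ : ∀ β : ℝ, 2 ≤ β → EqAdmissible β → ∀ β' : ℝ, β < β' →
      ∃ c : ℝ, ∀ n : ℕ, 1 ≤ n → ∃ E : EqSystem n, E.Correct ∧ ∃ e : ℕ, 1 ≤ e ∧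
        (∀ q : Fin n × Fin n, generator n q ^ e ∈
          Ideal.span (Set.range fun o : Fin E.tests.length => E.testPoly (E.tests.get o))) ∧
        Ψ e * ((E.cost : ℝ) + n * n) ≤ c * (n : ℝ) ^ β') :
    ∀ β : ℝ, 2 ≤ β → EqAdmissible β → ∀ β' : ℝ, β < β' →
      ∃ c : ℝ, ∀ n : ℕ, 1 ≤ n → ∃ E : EqSystem n, E.Correct ∧ ∃ e : ℕ, 1 ≤ e ∧
        (∀ q : Fin n × Fin n, generator n q ^ e ∈
          Ideal.span (Set.range fun o : Fin E.tests.length => E.testPoly (E.tests.get o))) ∧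
        Φ e * ((E.cost : ℝ) + n * n) ≤ c * (n : ℝ) ^ β' := by
  intro β hβ hA β' hβ'
  obtain ⟨c, hc⟩ := hΨ β hβ hA β' hβ'
  refine ⟨c, fun n hn => ?_⟩
  obtain ⟨E, hE, e, he, hmem, hΨe⟩ := hc n hn
  exact ⟨E, hE, e, he, hmem,
    (mul_le_mul_of_nonneg_right (hle e) (by positivity)).trans hΨe⟩

/-! ## Proved rungs in rank form -/

/-- **Rung `e = 1` in rank form, `Φ(1) = 2`** (`f_q ∈ J_E ⇒ R ≤ 2·cost`, M19i at the base `0`). -/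
theorem rankRung_one : ∀ n : ℕ, 1 ≤ n → ∀ E : EqSystem n, E.Correct →
    (∀ q : Fin n × Fin n, generator n q ^ 1 ∈
      Ideal.span (Set.range fun o : Fin E.tests.length => E.testPoly (E.tests.get o))) →
    (tensorRank (matMulTensor ℂ n n n) : ℝ) ≤ 2 * ((E.cost : ℝ) + n * n) := by
  intro n _ E hE hmem
  have h1 := hE.tensorRank_le_of_local_exponent_one 0 fun q =>
    ⟨1, by simp, by simpa only [map_one, one_mul, pow_one] using hmem q⟩
  have h2 : (tensorRank (matMulTensor ℂ n n n) : ℝ) ≤ 2 * (E.cost : ℝ) := by exact_mod_cast h1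
  have h0 : (0 : ℝ) ≤ (n : ℝ) * n := by positivity
  linarith

/-- **Rung `e = 2` in rank form, `Φ(2) = 6`** (`f_q² ∈ J_E ⇒ R ≤ 6·cost`, M19m). -/
theorem rankRung_two : ∀ n : ℕ, 1 ≤ n → ∀ E : EqSystem n, E.Correct →
    (∀ q : Fin n × Fin n, generator n q ^ 2 ∈
      Ideal.span (Set.range fun o : Fin E.tests.length => E.testPoly (E.tests.get o))) →
    (tensorRank (matMulTensor ℂ n n n) : ℝ) ≤ 6 * ((E.cost : ℝ) + n * n) := by
  intro n _ E hE hmem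
  have h1 := hE.tensorRank_le_of_sq_members_exact hmem
  have h2 : (tensorRank (matMulTensor ℂ n n n) : ℝ) ≤ 2 * (3 * (E.cost : ℝ)) := by exact_mod_cast h1
  have h0 : (0 : ℝ) ≤ (n : ℝ) * n := by positivity
  linarith

/-- **Every rung on TIGHT systems, with the explicit geometric constant `Φ(k+2) = 6·4^k`**: a correct
system with tests in `I^{k+1}` and `f_q^{k+2} ∈ J_E` gives `R(⟨n,n,n⟩) ≤ 6·4^k·(cost + n²)`
(`k` deflations along the pure initial ideal, M19d, then the level-`1` exact engine, M19m). -/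
theorem rankRung_tight (k : ℕ) {E : EqSystem n} (hE : E.Correct)
    (hdeep : ∀ j ∈ E.tests, E.testPoly j ∈ graphIdeal n ^ (k + 1))
    (hmem : ∀ q : Fin n × Fin n, generator n q ^ (k + 2) ∈
      Ideal.span (Set.range fun o : Fin E.tests.length => E.testPoly (E.tests.get o))) :
    tensorRank (matMulTensor ℂ n n n) ≤ 6 * (4 ^ k * (E.cost + n * n)) := by
  obtain ⟨E', hE', hmem', hcost'⟩ := hE.exists_sq_mem_of_deep k hdeep hmem
  have h1 := hE'.tensorRank_le_of_sq_members_exact hmem'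
  calc tensorRank (matMulTensor ℂ n n n) ≤ 2 * (3 * E'.cost) := h1
    _ = 6 * E'.cost := by ring
    _ ≤ 6 * (E'.cost + n * n) := Nat.mul_le_mul_left 6 (Nat.le_add_right _ _)
    _ ≤ 6 * (4 ^ k * (E.cost + n * n)) := Nat.mul_le_mul_left 6 hcost'

/-! ## The log-growth theorem (tight regime, unconditional) -/

/-- **LOG-GROWTH PURIFICATION.**  A family of correct TIGHT systems `E_n` (tests in `I^{k_n+1}`,
`f_q^{k_n+2} ∈ J_{E_n}`) with `4^{k_n}·(cost E_n + n²) ≤ c·n^β` forces `ω ≤ β` — the membership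
exponent may grow like `log n`. -/
theorem omega_le_of_tight_growth {β : ℝ}
    (h : ∃ c : ℝ, ∀ n : ℕ, 1 ≤ n → ∃ (E : EqSystem n) (k : ℕ), E.Correct ∧
      (∀ j ∈ E.tests, E.testPoly j ∈ graphIdeal n ^ (k + 1)) ∧
      (∀ q : Fin n × Fin n, generator n q ^ (k + 2) ∈
        Ideal.span (Set.range fun o : Fin E.tests.length => E.testPoly (E.tests.get o))) ∧
      (4 : ℝ) ^ k * ((E.cost : ℝ) + n * n) ≤ c * (n : ℝ) ^ β) :
    omega ℂ ≤ β := by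
  obtain ⟨c, hc⟩ := h
  refine omega_le_of_rank_family_le (K := 6 * c) fun n hn => ?_
  obtain ⟨E, k, hE, hdeep, hmem, hgrow⟩ := hc n hn
  have h1 : (tensorRank (matMulTensor ℂ n n n) : ℝ) ≤ 6 * ((4 : ℝ) ^ k * ((E.cost : ℝ) + n * n)) := by
    exact_mod_cast rankRung_tight k hE hdeep hmem
  linarith

/-- **LOG-GROWTH PURIFICATION, admissibility form**: the same family at `β` gives `EqAdmissibleRed β'`
for every `β' > β`. -/
theorem eqAdmissibleRed_of_tight_growth {β : ℝ}
    (h : ∃ c : ℝ, ∀ n : ℕ, 1 ≤ n → ∃ (E : EqSystem n) (k : ℕ), E.Correct ∧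
      (∀ j ∈ E.tests, E.testPoly j ∈ graphIdeal n ^ (k + 1)) ∧
      (∀ q : Fin n × Fin n, generator n q ^ (k + 2) ∈
        Ideal.span (Set.range fun o : Fin E.tests.length => E.testPoly (E.tests.get o))) ∧
      (4 : ℝ) ^ k * ((E.cost : ℝ) + n * n) ≤ c * (n : ℝ) ^ β) :
    ∀ β' : ℝ, β < β' → EqAdmissibleRed β' := fun _ hβ' =>
  eqAdmissibleRed_of_omega_lt ((omega_le_of_tight_growth h).trans_lt hβ')

/-! ## Where the crux stands on the dial -/

/-- **MultiplicityReduction ⟸ (rungs `e ≥ 3` in rank form with costs `Ψ(e)`) ∧ HAND_{6,6,Ψ(3),…}**: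
rungs `e ≤ 2` are plugged in with their proved constants (`2 ≤ 6`, `6`). -/
theorem multiplicityReduction_of_dial_ge_three (Ψ : ℕ → ℝ)
    (hRUNG : ∀ e : ℕ, 3 ≤ e → ∀ n : ℕ, 1 ≤ n → ∀ E : EqSystem n, E.Correct →
      (∀ q : Fin n × Fin n, generator n q ^ e ∈
        Ideal.span (Set.range fun o : Fin E.tests.length => E.testPoly (E.tests.get o))) →
      (tensorRank (matMulTensor ℂ n n n) : ℝ) ≤ Ψ e * ((E.cost : ℝ) + n * n))
    (hHAND : ∀ β : ℝ, 2 ≤ β → EqAdmissible β → ∀ β' : ℝ, β < β' →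
      ∃ c : ℝ, ∀ n : ℕ, 1 ≤ n → ∃ E : EqSystem n, E.Correct ∧ ∃ e : ℕ, 1 ≤ e ∧
        (∀ q : Fin n × Fin n, generator n q ^ e ∈
          Ideal.span (Set.range fun o : Fin E.tests.length => E.testPoly (E.tests.get o))) ∧
        (if e ≤ 2 then (6 : ℝ) else Ψ e) * ((E.cost : ℝ) + n * n) ≤ c * (n : ℝ) ^ β') :
    MultiplicityReduction := by
  refine multiplicityReduction_of_dial (fun e => if e ≤ 2 then (6 : ℝ) else Ψ e) ?_ hHAND
  intro e he n hn E hE hmem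
  by_cases h2 : e ≤ 2
  · simp only [h2, if_true]
    interval_cases e
    · have h := rankRung_one n hn E hE hmem
      have h0 : (0 : ℝ) ≤ (E.cost : ℝ) + n * n := by positivity
      linarith
    · exact rankRung_two n hn E hE hmem
  · simp only [h2, if_false]
    exact hRUNG e (by omega) n hn E hE hmem

end Summit.MatrixMultiplication.MatrixMultiplication.Theorems.GraphEquations

end
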